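import Summits.HodgeConjecture.HodgeConjecture.Theorems.K2LiuDoublingHeightArchDecay           -- ★ B4′ (p857095): `exists_decay_archHeight` (sharp decay `Φ(ι(g,1)) ≤ C H_∞(g)⁻¹`)
import Summits.HodgeConjecture.HodgeConjecture.Theorems.K2LiuArchHeightBallRankOne            -- ★ B3′ (p857138): `haar_arch_heightBall_le` (`ν{H_∞ ≤ R} ≤ C R²`)
import Summits.HodgeConjecture.HodgeConjecture.Theorems.K2LiuDoublingHeightShellBound          -- ★ B1 (p857034): `integrable_of_shellBound`
import Summits.HodgeConjecture.HodgeConjecture.Theorems.K2LiuDoublingUnfoldBridge              -- ★ H5 (K2Liu-p05): `simil_inv_of_formCongr`, `exists_continuousMulEquiv_eq_iotaA`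
import Summits.HodgeConjecture.HodgeConjecture.Theorems.K2LiuDoublingEmbeddingPlaceComponents  -- ★ file 2a (K2Liu-p05): `archPart_placesEmbed`
import Literature.NumberTheory.Automorphic.LeviEmbeddingGLHeight                               -- ★ `GLn.one_le_mul_archHeight_sq` (`1 ≤ N H_∞²`)
import HarnessLib

/-!
# Crux `HLiu418`, Track B road `K2_Liu`, unit U5d, socket #32dR — organ (B∞): THE ARCHIMEDEAN SLICE of the local height-decay integrability
# `∫_{G_∞} Φ(ι(ιA(a, 1), 1))^τ dν_∞(a) < ∞` for `τ > 2 = 2N − 2`, `N = 2`, one indefinite place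

Cell `hodgecm-mathlib`, crux item hLiu418 = `stmt-HodgeConjecture-24832`, route of record `HCCMUnconditional`; squad K2 ∕ K2Liu, LEAD F0P6-plan (g10∕g11),
typist K2Liu-plan (g2), prover K2Liu-p02 (g3) (LEAD deal 03:15:05Z).  THEOREMS ONLY; lane `--supports stmt-HodgeConjecture-24832 --as helper` (count-neutral).

WHAT IS PROVED.  **`doublingHeightArchSlice`** = the hypothesis `_harch` of ★ p856795 `K2LiuDoublingHeightDecayLocalOfSlices.doublingHeightDecayLocal_of_slices`
under the binders of socket #32dR `sig_K2LiuDoublingHeightDecayLocalR2` (`Cruxes/HLiu418/Lines/K2_Liu_CurveThetaSigs_U5d_ZetaS.lean`, ED. 5 :554; the shared binder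
prefix `L [inst×3] {n} e dV hdV hdV0 ι hpos dW hdW hdW0 H t ht g hg ιA hιA S [DecidableEq] [MeasurableSpace∕BorelSpace arch] νinf [IsHaarMeasure] Φ hΦc hΦpos hΦ τ hτ`
verbatim, the finite-place data `νS` and its instances dropped): for every Haar measure `ν_∞` on `G_∞ = U(H)(L⁺ ⊗ ℝ)` and every continuous positive height `Φ`
of type `(P_Δ, modDelta)` on `H(𝔸)`, **`a ↦ Φ(ι(ιA(placesEmbed(a, 1)), 1))^τ` is `ν_∞`-integrable for `τ > 2`.**

THE PROOF (height shells; [GelbartPiatetskishapiroRallis1987, Part A §2, §6]; [Liu2011, §2B Prop. 2.3]; [BorelJacquet1979, §1.2, §4.1]).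
(1) FRAME: by ★ (K0∞) `exists_archSimilCongr` at the similitude `ᵗ(c g⁻¹)·diag(dV)·g⁻¹ = t • H` (★ `simil_inv_of_formCongr`) there is
`Θ : G_∞ ≃ₜ* U(diag dV)(L⁺ ⊗ ℝ)`, `a ↦ (g⊗1)⁻¹ a (g⊗1)`, and the archimedean component of `ιA(placesEmbed(a,1))` is `Θ a` (★ `hιA`, ★ `toMixed_toAdeleGL`,
★ `archPart_placesEmbed`), so `H_∞(ιA(placesEmbed(a,1))) = H_∞(Θ a)`.  (2) DECAY: ★ B4′ `Φ(ι(y,1)) ≤ C₁ H_∞(y)⁻¹` on `U(diag dV)(𝔸)`.  (3) VOLUME: `Θ_* ν_∞` is a Haar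
measure of `U(diag dV)(L⁺ ⊗ ℝ)`, so ★ B3′ gives `ν_∞{a : H_∞(Θ a) ≤ R} ≤ C₂ R²`.  (4) SHELLS `S_k = {e^{k−1} ≤ H_∞(Θ a) ≤ e^k}` (`k ∈ ℕ`; they cover since
`H_∞ ≥ 1∕√2 > e⁻¹`, ★ `GLn.one_le_mul_archHeight_sq`): `ψ^τ ≤ (C₁e)^τ e^{−τk}` on `S_k`, `ν_∞(S_k) ≤ C₂ e^{2k}`, and `Σ_k e^{(2−τ)k} < ∞` iff `τ > 2` — ★ B1
`integrable_of_shellBound`.  The exponent is SHARP on both sides (`Φ ≍ (cosh s)⁻¹ ≍ H_∞⁻¹` along the `U(1,1)` boost, Haar `∝ sinh 2s ds`).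

HONEST LABEL.  `HC_CM` is proved only modulo the 7 printed citations (2 remaining named inputs: hLiu418 = `stmt-HodgeConjecture-24832`, h413 =
`stmt-HodgeConjecture-24833`) until rung 0 closes; this file is organ (B∞) of socket #32dR (one hypothesis of K2Liu-p09's #34 assembler) and retires nothing by itself.
-/

set_option autoImplicit false
-- the mandated namespace repeats the single-problem summit's segment (`HodgeConjecture.HodgeConjecture`)
set_option linter.dupNamespace false

noncomputable section

open scoped Matrix NNReal ENNReal MatrixGroups ComplexOrder Classical
open MeasureTheory MeasureTheory.Measure Set NumberField NumberField.InfinitePlace NumberField.mixedEmbedding IsDedekindDomain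

namespace Summit.HodgeConjecture.HodgeConjecture.Cruxes.HLiu418.K2LiuDoublingHeightArchSlice

open Literature.NumberTheory.Automorphic Literature.NumberTheory.Automorphic.UnitaryGroup
open Literature.NumberTheory.GelbartRogawski1991 Literature.NumberTheory.GelbartRogawski1991.GRConstruction
open Literature.NumberTheory.K2Lit.SiegelDoubled Literature.NumberTheory.K2Lit.PlaceSplitting
open Summit.HodgeConjecture.HodgeConjecture.Cruxes.HLiu418.K2LiuDoublingUnfoldBridge
open Summit.HodgeConjecture.HodgeConjecture.Cruxes.HLiu418.K2LiuDoublingEmbeddingPlaceComponents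
open Summit.HodgeConjecture.HodgeConjecture.Cruxes.HLiu418.K2LiuDoublingHeightShellBound
open Summit.HodgeConjecture.HodgeConjecture.Cruxes.HLiu418.K2LiuDoublingHeightArchDecay
open Summit.HodgeConjecture.HodgeConjecture.Cruxes.HLiu418.K2LiuArchHeightBallRankOne

/-! ## §1 Elementary lemmas: the lower bound `H_∞ ≥ e⁻¹`, continuity of `H_∞`, the shell index, the geometric majorant -/

/-- `e⁻¹ ≤ H_∞(y)` on `GL₂(𝔸_L)`: `1 ≤ 2 H_∞²` (★ `GLn.one_le_mul_archHeight_sq`) and `2e⁻² ≤ 1`. [cite: BorelJacquet1979, §1.2] -/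
theorem exp_neg_one_le_archHeight {K : Type} [Field K] [NumberField K] (y : GL (Fin 2) (AdeleRing (𝓞 K) K)) :
    Real.exp (-1) ≤ (GLn.archHeight 2 K y : ℝ) := by
  have h1 : (1 : ℝ) ≤ 2 * (GLn.archHeight 2 K y : ℝ) ^ 2 := by exact_mod_cast GLn.one_le_mul_archHeight_sq (m := 2) y
  have h0 : 0 ≤ (GLn.archHeight 2 K y : ℝ) := NNReal.coe_nonneg _
  have he : (3 : ℝ) ≤ Real.exp 2 := by linarith [Real.add_one_le_exp (2 : ℝ)]
  have he2 : Real.exp (-1) ^ 2 * Real.exp 2 = 1 := by rw [sq, ← Real.exp_add, ← Real.exp_add]; norm_num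
  by_contra hlt
  rw [not_le] at hlt
  have h2 : (GLn.archHeight 2 K y : ℝ) ^ 2 < Real.exp (-1) ^ 2 := by
    rw [sq, sq]; exact mul_self_lt_mul_self h0 hlt
  nlinarith [Real.exp_pos (-1), Real.exp_pos 2]

/-- `b ↦ H_∞(b)` is continuous on `GL_N(L ⊗ ℝ)` (entries of `b`, `b⁻¹` and finite suprema are continuous; ★ `GLn.toMixed_ofInfinite`). [cite: BorelJacquet1979, §1.2] -/
theorem continuous_archHeight_ofInfinite {K : Type} [Field K] [NumberField K] {N : ℕ} :
    Continuous fun b : GL (Fin N) (mixedSpace K) => (GLn.archHeight N K (GLn.ofInfinite N K b) : ℝ) := by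
  refine NNReal.continuous_coe.comp ?_
  have h : (fun b : GL (Fin N) (mixedSpace K) => GLn.archHeight N K (GLn.ofInfinite N K b)) = fun b : GL (Fin N) (mixedSpace K) =>
      Finset.univ.sup fun ij : Fin N × Fin N => ‖(b : Matrix (Fin N) (Fin N) (mixedSpace K)) ij.1 ij.2‖₊ ⊔
        ‖((b⁻¹ : GL (Fin N) (mixedSpace K)) : Matrix (Fin N) (Fin N) (mixedSpace K)) ij.1 ij.2‖₊ := by
    funext b; unfold GLn.archHeight; rw [GLn.toMixed_ofInfinite]
  rw [h]
  refine Continuous.finset_sup_apply fun ij _ => Continuous.sup ?_ ?_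
  · exact (Units.continuous_val.matrix_elem ij.1 ij.2).nnnorm
  · exact (Units.continuous_coe_inv.matrix_elem ij.1 ij.2).nnnorm

/-- The shell index: for `x ≥ −1` the natural number `k = ⌈x⌉₊` has `k − 1 ≤ x ≤ k`. [folklore] -/
theorem exists_nat_sub_one_le_le {x : ℝ} (hx : -1 ≤ x) : ∃ k : ℕ, (k : ℝ) - 1 ≤ x ∧ x ≤ k := by
  refine ⟨⌈x⌉₊, ?_, Nat.le_ceil x⟩
  rcases le_or_gt 0 x with h | h
  · linarith [Nat.ceil_lt_add_one h]
  · rw [Nat.ceil_eq_zero.2 h.le, Nat.cast_zero]; linarith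

/-- On the shell `e^{k−1} ≤ h ≤ e^k`: `C h⁻¹ ≤ (C e) e^{−k}` (`C ≥ 0`). [folklore] -/
theorem mul_inv_le_on_shell {C h : ℝ} (hC : 0 ≤ C) (k : ℕ) (hk : Real.exp ((k : ℝ) - 1) ≤ h) :
    C * h⁻¹ ≤ C * Real.exp 1 * Real.exp (-(k : ℝ)) := by
  have hpos : 0 < Real.exp ((k : ℝ) - 1) := Real.exp_pos _
  have h1 : h⁻¹ ≤ (Real.exp ((k : ℝ) - 1))⁻¹ := inv_anti₀ hpos hk
  have h2 : (Real.exp ((k : ℝ) - 1))⁻¹ = Real.exp 1 * Real.exp (-(k : ℝ)) := by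
    rw [← Real.exp_neg, ← Real.exp_add]; congr 1; ring
  calc C * h⁻¹ ≤ C * (Real.exp ((k : ℝ) - 1))⁻¹ := mul_le_mul_of_nonneg_left h1 hC
    _ = C * Real.exp 1 * Real.exp (-(k : ℝ)) := by rw [h2, mul_assoc]

/-- The geometric majorant: `C₂ e^{2k} · ((C₁e)^τ e^{−τk}) = (C₂ (C₁e)^τ) · (e^{2−τ})^k`. [folklore] -/
theorem shell_term_eq (C₁ C₂ τ : ℝ) (k : ℕ) :
    C₂ * Real.exp (k : ℝ) ^ 2 * ((C₁ * Real.exp 1) ^ τ * Real.exp (-(τ * k))) =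
      C₂ * (C₁ * Real.exp 1) ^ τ * Real.exp (2 - τ) ^ k := by
  have h : Real.exp (k : ℝ) ^ 2 * Real.exp (-(τ * k)) = Real.exp (2 - τ) ^ k := by
    rw [sq, ← Real.exp_add, ← Real.exp_add, ← Real.exp_nat_mul]; congr 1; ring
  calc C₂ * Real.exp (k : ℝ) ^ 2 * ((C₁ * Real.exp 1) ^ τ * Real.exp (-(τ * k)))
      = C₂ * (C₁ * Real.exp 1) ^ τ * (Real.exp (k : ℝ) ^ 2 * Real.exp (-(τ * k))) := by ring
    _ = C₂ * (C₁ * Real.exp 1) ^ τ * Real.exp (2 - τ) ^ k := by rw [h]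

/-! ## §2 Organ (B∞): the archimedean slice of #32dR -/

set_option maxHeartbeats 400000 in
/-- **ORGAN (B∞) — THE ARCHIMEDEAN SLICE OF SOCKET #32dR `sig_K2LiuDoublingHeightDecayLocalR2`** (U5d ED. 5 :554; binder prefix verbatim, the finite-place data
`νS` dropped; the conclusion is the hypothesis `_harch` of ★ `doublingHeightDecayLocal_of_slices`, p856795).  For `N = 2`, real non-zero `dV` DEFINITE at every complex
embedding off the place of `ι`, the similitude frame `(t, g, ιA)` of s23, every Haar measure `ν_∞` on `G_∞ = U(H)(L⁺ ⊗ ℝ)` and every continuous positive height `Φ` of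
type `(P_Δ, modDelta)` on `H(𝔸)`: **`∫_{G_∞} Φ(ι(ιA(placesEmbed(a, 1)), 1))^τ dν_∞(a) < ∞` for every `τ > 2 · 2 − 2 = 2`.**  Height shells on `H_∞(Θ a)`,
`Θ a = (g⊗1)⁻¹ a (g⊗1)` (★ `exists_archSimilCongr`): sharp decay ★ B4′ `exists_decay_archHeight`, sharp volume ★ B3′ `haar_arch_heightBall_le`, ★ B1
`integrable_of_shellBound`, `Σ_k e^{(2−τ)k} < ∞`. [cite: GelbartPiatetskishapiroRallis1987, Part A §2, §6] [cite: Liu2011, §2B Prop. 2.3 p. 862]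
[cite: BorelJacquet1979, §1.2, §4.1] [cite: BeuzartPlessis2020Asterisque, §1.5 (1.5.2)–(1.5.3) p. 31] -/
theorem doublingHeightArchSlice :
    ∀ (L : Type) [Field L] [NumberField L] [IsCMField L] {n : ℕ} (e : Fin 2 × Fin 1 ≃ Fin n)
      (dV : Fin 2 → L) (hdV : ∀ i, IsCMField.complexConj L (dV i) = dV i) (_hdV0 : ∀ i, dV i ≠ 0)
      (ι : L →+* ℂ) (_hpos : ∀ τ' : L →+* ℂ, InfinitePlace.mk τ' ≠ InfinitePlace.mk ι → ((Matrix.diagonal dV).map τ').PosDef)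
      (dW : Fin 1 → L) (hdW : ∀ i, IsCMField.complexConj L (dW i) = dW i) (_hdW0 : ∀ i, dW i ≠ 0)
      (H : Matrix (Fin 2) (Fin 2) L)
      (t : L) (_ht : t ≠ 0) (g : GL (Fin 2) L)
      (_hg : formCongr ((IsCMField.complexConj L : L ≃ₐ[↥(maximalRealSubfield L)] L) : L →+* L) g (t • H) = Matrix.diagonal dV)
      (ιA : (UnitaryGroup.adelicGroupData (Fp L) L (IsCMField.complexConj L) 2 H).Adelic →*
        UnitaryGroup.adelic (Fp L) L (IsCMField.complexConj L) 2 (Matrix.diagonal dV))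
      (_hιA : ∀ k, ((ιA k : ↥(UnitaryGroup.adelic (Fp L) L (IsCMField.complexConj L) 2 (Matrix.diagonal dV))) :
            GL (Fin 2) (AdeleRing (𝓞 L) L)) =
          (toAdeleGL L g)⁻¹ * UnitaryGroup.adelicVal (Fp L) L (IsCMField.complexConj L) 2 H k * toAdeleGL L g)
      (S : Finset (HeightOneSpectrum (𝓞 (Fp L)))) [DecidableEq (HeightOneSpectrum (𝓞 (Fp L)))]
      [MeasurableSpace (UnitaryGroup.arch (Fp L) L (IsCMField.complexConj L) 2 H)]
      [BorelSpace (UnitaryGroup.arch (Fp L) L (IsCMField.complexConj L) 2 H)]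
      (νinf : Measure (UnitaryGroup.arch (Fp L) L (IsCMField.complexConj L) 2 H)) [νinf.IsHaarMeasure]
      (Φ : HA L e dV hdV dW hdW → ℝ) (_hΦc : Continuous Φ) (_hΦpos : ∀ x, 0 < Φ x)
      (_hΦ : ∀ p x : HA L e dV hdV dW hdW, IsSiegelDelta L e dV hdV dW hdW p →
        Φ (p * x) = modDelta L e dV hdV dW hdW p * Φ x)
      (τ : ℝ) (_hτ : 2 * (2 : ℝ) - 2 < τ),
      Integrable (fun a => Φ (iotaLeft L e dV hdV dW hdW (ιA (placesEmbed L H S (a, 1)))) ^ τ) νinf := by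
  intro L _ _ _ n e dV hdV hdV0 ι hpos dW hdW hdW0 H t ht g hg ιA hιA S _ _ _ νinf _ Φ hΦc hΦpos hΦ τ hτ
  have hτ2 : 2 < τ := by linarith
  have hτ0 : 0 ≤ τ := by linarith
  -- (1) FRAME: `Θ a = (g⊗1)⁻¹ a (g⊗1)` and `H_∞(ιA(placesEmbed(a,1))) = H_∞(Θ a)`
  obtain ⟨Θ, hΘ⟩ := exists_archSimilCongr L 2 (Matrix.diagonal dV) H t ht g⁻¹ (simil_inv_of_formCongr L H dV t g hg)
  have hmix : ∀ a : UnitaryGroup.arch (Fp L) L (IsCMField.complexConj L) 2 H,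
      GLn.toMixed 2 L ((ιA (placesEmbed L H S (a, 1)) : ↥(UnitaryGroup.adelic (Fp L) L (IsCMField.complexConj L) 2 (Matrix.diagonal dV))) :
        GL (Fin 2) (AdeleRing (𝓞 L) L)) =
      ((Θ a : UnitaryGroup.arch (Fp L) L (IsCMField.complexConj L) 2 (Matrix.diagonal dV)) : GL (Fin 2) (mixedSpace L)) := fun a => by
    have harch : GLn.toMixed 2 L (UnitaryGroup.adelicVal (Fp L) L (IsCMField.complexConj L) 2 H (placesEmbed L H S (a, 1))) =
        (a : GL (Fin 2) (mixedSpace L)) :=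
      congrArg (fun x : UnitaryGroup.arch (Fp L) L (IsCMField.complexConj L) 2 H => (x : GL (Fin 2) (mixedSpace L))) (archPart_placesEmbed L H S a 1)
    rw [hιA, map_mul, map_mul, map_inv, toMixed_toAdeleGL, harch, hΘ, map_inv, inv_inv]
  have hheight : ∀ a : UnitaryGroup.arch (Fp L) L (IsCMField.complexConj L) 2 H,
      GLn.archHeight 2 L ((ιA (placesEmbed L H S (a, 1)) : ↥(UnitaryGroup.adelic (Fp L) L (IsCMField.complexConj L) 2 (Matrix.diagonal dV))) :
        GL (Fin 2) (AdeleRing (𝓞 L) L)) =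
      GLn.archHeight 2 L (GLn.ofInfinite 2 L ((Θ a : UnitaryGroup.arch (Fp L) L (IsCMField.complexConj L) 2 (Matrix.diagonal dV)) :
        GL (Fin 2) (mixedSpace L))) := fun a => by
    unfold GLn.archHeight
    rw [GLn.toMixed_ofInfinite, hmix]
  -- the height function of the shells and its properties
  set hfun : UnitaryGroup.arch (Fp L) L (IsCMField.complexConj L) 2 H → ℝ := fun a =>
    (GLn.archHeight 2 L (GLn.ofInfinite 2 L ((Θ a : UnitaryGroup.arch (Fp L) L (IsCMField.complexConj L) 2 (Matrix.diagonal dV)) :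
      GL (Fin 2) (mixedSpace L))) : ℝ) with hhfun
  have hcont : Continuous hfun := continuous_archHeight_ofInfinite.comp (continuous_subtype_val.comp Θ.continuous)
  have hlow : ∀ a, Real.exp (-1) ≤ hfun a := fun a => by
    have h := exp_neg_one_le_archHeight ((ιA (placesEmbed L H S (a, 1)) :
      ↥(UnitaryGroup.adelic (Fp L) L (IsCMField.complexConj L) 2 (Matrix.diagonal dV))) : GL (Fin 2) (AdeleRing (𝓞 L) L))
    rwa [hheight] at h
  have hfpos : ∀ a, 0 < hfun a := fun a => lt_of_lt_of_le (Real.exp_pos _) (hlow a)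
  -- (2) DECAY (★ B4′)
  obtain ⟨C₁, hC₁, hdec⟩ := exists_decay_archHeight L e dV hdV dW hdW hdV0 hdW0 Φ hΦc hΦ
  set ψ : UnitaryGroup.arch (Fp L) L (IsCMField.complexConj L) 2 H → ℝ := fun a =>
    Φ (iotaLeft L e dV hdV dW hdW (ιA (placesEmbed L H S (a, 1)))) with hψdef
  have hψle : ∀ a, ψ a ≤ C₁ * (hfun a)⁻¹ := fun a => by
    have h := hdec (ιA (placesEmbed L H S (a, 1)))
    rwa [hheight] at h
  have hψpos : ∀ a, 0 < ψ a := fun a => hΦpos _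
  -- (3) VOLUME (★ B3′ for the Haar measure `Θ_* ν_∞`)
  letI mD : MeasurableSpace ↥(UnitaryGroup.arch (Fp L) L (IsCMField.complexConj L) 2 (Matrix.diagonal dV)) := borel _
  haveI : BorelSpace ↥(UnitaryGroup.arch (Fp L) L (IsCMField.complexConj L) 2 (Matrix.diagonal dV)) := ⟨rfl⟩
  set ν' : Measure ↥(UnitaryGroup.arch (Fp L) L (IsCMField.complexConj L) 2 (Matrix.diagonal dV)) := Measure.map Θ νinf with hν'
  haveI : ν'.IsHaarMeasure := by rw [hν']; infer_instance
  obtain ⟨C₂, hC₂0, hvol⟩ := haar_arch_heightBall_le L dV hdV hdV0 ι hpos ν'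
  have hball : ∀ R : ℝ, 1 ≤ R → νinf {a | hfun a ≤ R} ≤ ENNReal.ofReal (C₂ * R ^ 2) := fun R hR => by
    have hpre : {a | hfun a ≤ R} = Θ ⁻¹' {b | (GLn.archHeight 2 L (GLn.ofInfinite 2 L
        (b : GL (Fin 2) (mixedSpace L))) : ℝ) ≤ R} := rfl
    rw [hpre]
    exact (le_map_apply Θ.continuous.measurable.aemeasurable _).trans (hvol R hR)
  -- (4) SHELLS `S_k = {e^{k-1} ≤ hfun ≤ e^k}`
  set Sh : ℕ → Set (UnitaryGroup.arch (Fp L) L (IsCMField.complexConj L) 2 H) := fun k =>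
    {a | Real.exp ((k : ℝ) - 1) ≤ hfun a ∧ hfun a ≤ Real.exp k} with hSh
  have hcover : (⋃ k, Sh k) = Set.univ := by
    refine Set.eq_univ_of_forall fun a => ?_
    have hlog : -1 ≤ Real.log (hfun a) := (Real.le_log_iff_exp_le (hfpos a)).2 (hlow a)
    obtain ⟨k, hk1, hk2⟩ := exists_nat_sub_one_le_le hlog
    refine Set.mem_iUnion.2 ⟨k, ?_, ?_⟩
    · exact (Real.le_log_iff_exp_le (hfpos a)).1 hk1
    · exact (Real.log_le_iff_le_exp (hfpos a)).1 hk2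
  have hSmeas : ∀ k, MeasurableSet (Sh k) := fun k => (isClosed_Icc.preimage hcont).measurableSet
  have hSvol : ∀ k : ℕ, νinf (Sh k) ≤ ENNReal.ofReal (C₂ * Real.exp (k : ℝ) ^ 2) := fun k =>
    (measure_mono fun a ha => ha.2).trans (hball _ (Real.one_le_exp (Nat.cast_nonneg k)))
  have hSfin : ∀ k, νinf (Sh k) ≠ ∞ := fun k => ne_top_of_le_ne_top ENNReal.ofReal_ne_top (hSvol k)
  -- the integrand and its shell bounds
  have hψc : Continuous ψ := by
    obtain ⟨Ψ, -, hΨ⟩ := exists_continuousMulEquiv_eq_iotaA L H dV t ht g hg ιA hιA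
    have hιc : Continuous ιA := by
      have h : (ιA : _ → _) = Ψ := funext fun x => (hΨ x).symm
      rw [h]; exact Ψ.continuous
    exact hΦc.comp ((continuous_iotaLeft L e dV hdV dW hdW).comp (hιc.comp ((continuous_placesEmbed L H S).comp
      (continuous_id.prodMk continuous_const))))
  set M : ℕ → ℝ := fun k => (C₁ * Real.exp 1) ^ τ * Real.exp (-(τ * k)) with hM
  have hM0 : ∀ k, 0 ≤ M k := fun k => mul_nonneg (Real.rpow_nonneg (mul_nonneg hC₁.le (Real.exp_pos 1).le) τ) (Real.exp_pos _).le
  have hle : ∀ k, ∀ a ∈ Sh k, ψ a ^ τ ≤ M k := fun k a ha => by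
    have h1 : ψ a ≤ C₁ * Real.exp 1 * Real.exp (-(k : ℝ)) := (hψle a).trans (mul_inv_le_on_shell hC₁.le k ha.1)
    calc ψ a ^ τ ≤ (C₁ * Real.exp 1 * Real.exp (-(k : ℝ))) ^ τ := Real.rpow_le_rpow (hψpos a).le h1 hτ0
      _ = M k := by
          rw [hM]; dsimp only
          rw [Real.mul_rpow (mul_nonneg hC₁.le (Real.exp_pos 1).le) (Real.exp_pos _).le, ← Real.exp_mul]
          congr 2; ring
  -- (5) the geometric series `Σ_k C₂ e^{2k} (C₁e)^τ e^{-τk} = A Σ_k (e^{2-τ})^k`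
  have hr0 : 0 ≤ Real.exp (2 - τ) := (Real.exp_pos _).le
  have hr1 : Real.exp (2 - τ) < 1 := Real.exp_lt_one_iff.2 (by linarith)
  have hsum : Summable fun k : ℕ => (νinf (Sh k)).toReal * M k := by
    refine Summable.of_nonneg_of_le (fun k => mul_nonneg ENNReal.toReal_nonneg (hM0 k)) (fun k => ?_)
      ((summable_geometric_of_lt_one hr0 hr1).mul_left (C₂ * (C₁ * Real.exp 1) ^ τ))
    have hv : (νinf (Sh k)).toReal ≤ C₂ * Real.exp (k : ℝ) ^ 2 :=
      ENNReal.toReal_le_of_le_ofReal (mul_nonneg hC₂0 (sq_nonneg _)) (hSvol k)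
    calc (νinf (Sh k)).toReal * M k ≤ C₂ * Real.exp (k : ℝ) ^ 2 * M k := mul_le_mul_of_nonneg_right hv (hM0 k)
      _ = C₂ * (C₁ * Real.exp 1) ^ τ * Real.exp (2 - τ) ^ k := shell_term_eq C₁ C₂ τ k
  -- ★ B1
  exact integrable_of_shellBound νinf hcover hSmeas hSfin ((hψc.rpow_const fun a => Or.inl (hψpos a).ne').aestronglyMeasurable)
    (fun a => Real.rpow_nonneg (hψpos a).le τ) hM0 hle hsum

end Summit.HodgeConjecture.HodgeConjecture.Cruxes.HLiu418.K2LiuDoublingHeightArchSlice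

end
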